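import Mathlib
import Summits.NavierStokesRegularity.OSWSelfSimilar.SheetNSLineTorusCascadeCellChecker
import HarnessLib

/-!
# Viscous CLM on the torus (`a = 0`, `σ = 2`): soundness of ONE CELL of the reflective cell-chain checker

HONEST FRAMING (cell ns-blowup GROUP B «PROFILE SEARCH», zone Z3, row Z3-U addendum A-F2 of `HOME/profile/z3/CENSUS-Z3.md`;
human rulings D-0035/D-0074; Z3-TWIN lineage, eng-5 g13): **1-D MODEL (viscous Constantin–Lax–Majda equation `ω_t = ω Hω + ν ω_xx`
on `𝕋`); natural-number arithmetic + ODE comparison, kernel-checked; not Euler, not Navier–Stokes; «violates: none — MODEL».**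

For the checker `CellChain.cellLoop` of `SheetNSLineTorusCascadeCellChecker` and a sine cascade `IsSineCascade 1 c e`:
* `cdiv_spec` — the ceiling division rounds up;
* `stepLo_sound` / `stepUp_sound` — one mode: the fixed-point cell-end values and in-cell envelopes are honest
  (`cell_lb_readout` / `cell_ub_readout` of `SheetNSLineTorusCascadeCellEnvelope` with the roundings `⌊·⌋ ≤ · ≤ ⌈·⌉`);
* `IForall`, `IForall₂` (indexed list predicates), `Heads` (point bounds), `CellB` (in-cell bounds), `RhoOK` (decay brackets),
  `InTab` (the in-cell tables of the lower modes bound them);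
* `conv_bounds` — the tables give `dot mF mF.reverse / D² ≤ Σ_{i+j=k} e_i e_j ≤ dot MF MF.reverse / D²` (`antidiagonal_conv_mono`);
* **`cellLoop_sound`** — if the input lists bound the modes `k…K` at the cell start and `mF`/`MF` bound the modes `< k` on the
  whole cell, the four output lists bound the modes `k…K` at the cell end (`newlo`, `newup`) and on the whole cell (`mins`, `maxs`),
  and have the input length.
bears_on: LADDER-NS N5 / zone Z3 (row Z3-U) → N1 linear core. WHAT THIS IS NOT: not NS; no number certified by THIS file.
-/

namespace Summit.NavierStokesRegularity.OSWSelfSimilar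
namespace SheetNSLineTorusCascade
namespace CellChain

open Finset Real Set

/-! ### Arithmetic of the roundings -/

/-- The ceiling division rounds up: `a ≤ ⌈a/b⌉·b` and, over `ℝ`, `a/b ≤ ⌈a/b⌉` (`b > 0`). (Packaged as one statement; the
same two facts for an identically defined `cdiv` exist in `Literature.Barriers.CriticalPhenomena.…Thm22CertArith`, a module this
fluid-cascade file deliberately does not import.) [folklore] -/
theorem cdiv_spec (a : ℕ) {b : ℕ} (hb : 0 < b) : a ≤ cdiv a b * b ∧ (a : ℝ) / b ≤ (cdiv a b : ℕ) := by
  have h1 : a ≤ cdiv a b * b := by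
    unfold cdiv
    have := Nat.lt_div_mul_add (a := a + b - 1) hb
    omega
  refine ⟨h1, ?_⟩
  rw [div_le_iff₀ (by exact_mod_cast hb)]
  exact_mod_cast h1

/-! ### Soundness of one mode step and of one cell -/

section Sound

variable {c : ℝ} {e : ℕ → ℝ → ℝ}

/-- **One mode, lower side.** If `ℓ/D ≤ e_k(t₀)`, the lower convolution sum `s/D² ≤ Σ_{i+j=k} e_i e_j` on the cell, and
`ρ/D ≤ e^{−k²(t₁−t₀)} ≤ (ρ+1)/D ≤ 1`, then `stepLo/D ≤ e_k(t₁)` and `min ℓ stepLo / D ≤ e_k` on the cell. [new here — MODEL] -/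
theorem stepLo_sound (he : IsSineCascade 1 c e) {k : ℕ} (hk : 1 ≤ k) {D : ℕ} (hD : 0 < D)
    {t₀ t₁ : ℝ} (ht₀ : 0 ≤ t₀) (ht₁ : t₀ ≤ t₁) {s ℓ ρ : ℕ} (hℓ : (ℓ : ℝ) / D ≤ e k t₀)
    (hs : ∀ σ ∈ Icc t₀ t₁, (s : ℝ) / (D : ℝ) ^ 2 ≤ ∑ p ∈ antidiagonal k, e p.1 σ * e p.2 σ)
    (hρlo : (ρ : ℝ) / D ≤ exp (-(1 * (k : ℝ) ^ 2 * (t₁ - t₀))))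
    (hρhi : exp (-(1 * (k : ℝ) ^ 2 * (t₁ - t₀))) ≤ ((ρ : ℝ) + 1) / D) (hρD : ρ + 1 ≤ D) :
    (stepLo D k s ℓ ρ : ℝ) / D ≤ e k t₁ ∧ ∀ σ ∈ Icc t₀ t₁, (min ℓ (stepLo D k s ℓ ρ) : ℕ) / (D : ℝ) ≤ e k σ := by
  have hDr : (0 : ℝ) < D := by exact_mod_cast hD
  have hkpos : (0 : ℝ) < k := by exact_mod_cast hk
  have hkk : 0 < 2 * D * k * k := by positivity
  set φk : ℕ := s / (2 * D * k * k) with hφk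
  -- the rounded quasi-static value is below the true one
  have hφ' : (φk : ℝ) / D ≤ (1 / 2 * ((s : ℝ) / (D : ℝ) ^ 2)) / (1 * (k : ℝ) ^ 2) := by
    have h1 : (φk : ℝ) ≤ (s : ℝ) / ((2 * D * k * k : ℕ) : ℝ) := Nat.cast_div_le
    rw [div_le_iff₀ hDr]
    refine le_trans h1 (le_of_eq ?_)
    push_cast
    field_simp
  have key := cell_lb_readout he one_pos hk ht₀ ht₁ (by positivity : (0 : ℝ) ≤ (ℓ : ℝ) / D) hℓ
    (φ := 1 / 2 * ((s : ℝ) / (D : ℝ) ^ 2)) (fun σ hσ => by have := hs σ hσ; linarith)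
    (by positivity : (0 : ℝ) ≤ (φk : ℝ) / D) hφ' hρlo hρhi (nlo := (stepLo D k s ℓ ρ : ℝ) / D) (by
      -- nlo/D ≤ φ'(1 − ρhi) + ℓ ρlo
      have hsub : ((D - (ρ + 1) : ℕ) : ℝ) = (D : ℝ) - ((ρ : ℝ) + 1) := by
        rw [Nat.cast_sub hρD]; push_cast; ring
      have h1 : ((stepLo D k s ℓ ρ : ℕ) : ℝ) ≤ ((φk * (D - (ρ + 1)) + ℓ * ρ : ℕ) : ℝ) / (D : ℝ) := by
        rw [stepLo, ← hφk]; exact Nat.cast_div_le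
      rw [div_le_iff₀ hDr]
      refine le_trans h1 (le_of_eq ?_)
      push_cast
      rw [hsub]
      field_simp)
  refine ⟨key.1, fun σ hσ => ?_⟩
  have h := key.2 σ hσ
  rw [Nat.cast_min, ← min_div_div_right hDr.le]
  exact h

/-- **One mode, upper side.** If `e_k(t₀) ≤ u/D`, `Σ_{i+j=k} e_i e_j ≤ S/D²` on the cell, and `ρ/D ≤ e^{−k²(t₁−t₀)} ≤ (ρ+1)/D`
(`ρ ≤ D`), then `e_k(t₁) ≤ stepUp/D` and `e_k ≤ max u stepUp / D` on the cell. [new here — MODEL] -/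
theorem stepUp_sound (he : IsSineCascade 1 c e) {k : ℕ} (hk : 1 ≤ k) {D : ℕ} (hD : 0 < D)
    {t₀ t₁ : ℝ} (ht₀ : 0 ≤ t₀) (ht₁ : t₀ ≤ t₁) {S u ρ : ℕ} (hu : e k t₀ ≤ (u : ℝ) / D)
    (hS : ∀ σ ∈ Icc t₀ t₁, ∑ p ∈ antidiagonal k, e p.1 σ * e p.2 σ ≤ (S : ℝ) / (D : ℝ) ^ 2)
    (hρlo : (ρ : ℝ) / D ≤ exp (-(1 * (k : ℝ) ^ 2 * (t₁ - t₀))))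
    (hρhi : exp (-(1 * (k : ℝ) ^ 2 * (t₁ - t₀))) ≤ ((ρ : ℝ) + 1) / D) (hρD : ρ ≤ D) :
    e k t₁ ≤ (stepUp D k S u ρ : ℝ) / D ∧ ∀ σ ∈ Icc t₀ t₁, e k σ ≤ (max u (stepUp D k S u ρ) : ℕ) / (D : ℝ) := by
  have hDr : (0 : ℝ) < D := by exact_mod_cast hD
  have hkpos : (0 : ℝ) < k := by exact_mod_cast hk
  have hkk : 0 < 2 * D * k * k := by positivity
  set Φk : ℕ := cdiv S (2 * D * k * k) with hΦk
  have hΦ' : (1 / 2 * ((S : ℝ) / (D : ℝ) ^ 2)) / (1 * (k : ℝ) ^ 2) ≤ (Φk : ℝ) / D := by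
    have h1 : (S : ℝ) / ((2 * D * k * k : ℕ) : ℝ) ≤ (Φk : ℝ) := (cdiv_spec S hkk).2
    rw [le_div_iff₀ hDr]
    refine le_trans (le_of_eq ?_) h1
    push_cast
    field_simp
  have key := cell_ub_readout he one_pos hk ht₀ ht₁ (by positivity : (0 : ℝ) ≤ (u : ℝ) / D) hu
    (Φ := 1 / 2 * ((S : ℝ) / (D : ℝ) ^ 2)) (fun σ hσ => by have := hS σ hσ; linarith)
    (by positivity : (0 : ℝ) ≤ (Φk : ℝ) / D) hΦ' hρlo hρhi (nup := (stepUp D k S u ρ : ℝ) / D) (by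
      have hsub : ((D - ρ : ℕ) : ℝ) = (D : ℝ) - (ρ : ℝ) := by rw [Nat.cast_sub hρD]
      have h1 : ((Φk * (D - ρ) + u * (ρ + 1) : ℕ) : ℝ) / (D : ℝ) ≤ ((stepUp D k S u ρ : ℕ) : ℝ) := by
        rw [stepUp, ← hΦk]; exact (cdiv_spec _ hD).2
      refine le_trans (le_of_eq ?_) (div_le_div_of_nonneg_right h1 hDr.le)
      push_cast
      rw [hsub]
      field_simp)
  refine ⟨key.1, fun σ hσ => ?_⟩
  have h := key.2 σ hσ
  rw [Nat.cast_max, ← max_div_div_right hDr.le]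
  exact h

/-- Indexed `Forall` on a list: `P k x₀ ∧ P (k+1) x₁ ∧ …`. [folklore] -/
def IForall (P : ℕ → ℕ → Prop) : ℕ → List ℕ → Prop
  | k, x :: xs => P k x ∧ IForall P (k + 1) xs
  | _, [] => True

/-- Indexed `Forall₂` on two lists of equal length: `P k x₀ y₀ ∧ P (k+1) x₁ y₁ ∧ …` (`False` on a length mismatch). [folklore] -/
def IForall₂ (P : ℕ → ℕ → ℕ → Prop) : ℕ → List ℕ → List ℕ → Prop
  | k, x :: xs, y :: ys => P k x y ∧ IForall₂ P (k + 1) xs ys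
  | _, [], [] => True
  | _, _, _ => False

/-- Point bounds of the modes `k, k+1, …` at time `t`, one per list entry: `ℓ/D ≤ e_k(t) ≤ u/D`. [new here — MODEL] -/
abbrev Heads (e : ℕ → ℝ → ℝ) (D : ℕ) (t : ℝ) : ℕ → List ℕ → List ℕ → Prop :=
  IForall₂ fun k ℓ u => (ℓ : ℝ) / D ≤ e k t ∧ e k t ≤ (u : ℝ) / D

/-- In-cell bounds of the modes `k, k+1, …` on `[t₀, t₁]`, one per list entry. [new here — MODEL] -/
abbrev CellB (e : ℕ → ℝ → ℝ) (D : ℕ) (t₀ t₁ : ℝ) : ℕ → List ℕ → List ℕ → Prop :=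
  IForall₂ fun k m M => ∀ σ ∈ Icc t₀ t₁, (m : ℝ) / D ≤ e k σ ∧ e k σ ≤ (M : ℝ) / D

/-- Decay brackets of the modes `k, k+1, …` on a cell of length `t₁ − t₀`: `ρ/D ≤ e^{−k²(t₁−t₀)} ≤ (ρ+1)/D ≤ 1`. [new here — MODEL] -/
abbrev RhoOK (D : ℕ) (t₀ t₁ : ℝ) : ℕ → List ℕ → Prop :=
  IForall fun k ρ => (ρ : ℝ) / D ≤ exp (-(1 * (k : ℝ) ^ 2 * (t₁ - t₀))) ∧
    exp (-(1 * (k : ℝ) ^ 2 * (t₁ - t₀))) ≤ ((ρ : ℝ) + 1) / D ∧ ρ + 1 ≤ D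

/-- The in-cell mode tables `mF`/`MF` of the modes `1 … k−1` bound those modes on the cell. [new here — MODEL] -/
structure InTab (e : ℕ → ℝ → ℝ) (D : ℕ) (t₀ t₁ : ℝ) (k : ℕ) (mF MF : List ℕ) : Prop where
  /-- `mF` lists the modes `1 … k−1` -/
  lenF : mF.length + 1 = k
  /-- `MF` lists the modes `1 … k−1` -/
  lenM : MF.length + 1 = k
  /-- the tables bound the modes on the cell -/
  tab : ∀ a, 1 ≤ a → a < k → ∀ σ ∈ Icc t₀ t₁, (lget mF a : ℝ) / D ≤ e a σ ∧ e a σ ≤ (lget MF a : ℝ) / D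

/-- **The convolution sums from the tables.** Under `InTab`, for every `σ` in the cell:
`dot mF mF.reverse / D² ≤ Σ_{i+j=k} e_i(σ) e_j(σ) ≤ dot MF MF.reverse / D²`. [new here — MODEL] -/
theorem conv_bounds (he : IsSineCascade 1 c e) (hc : 0 ≤ c) {D : ℕ} (hD : 0 < D) {t₀ t₁ : ℝ} (ht₀ : 0 ≤ t₀)
    {k : ℕ} {mF MF : List ℕ} (h : InTab e D t₀ t₁ k mF MF) {σ : ℝ} (hσ : σ ∈ Icc t₀ t₁) :
    (dot mF mF.reverse : ℝ) / (D : ℝ) ^ 2 ≤ ∑ p ∈ antidiagonal k, e p.1 σ * e p.2 σ ∧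
      ∑ p ∈ antidiagonal k, e p.1 σ * e p.2 σ ≤ (dot MF MF.reverse : ℝ) / (D : ℝ) ^ 2 := by
  obtain ⟨hlen, hLen, htab⟩ := h
  have hDr : (0 : ℝ) < D := by exact_mod_cast hD
  have hσ0 : 0 ≤ σ := le_trans ht₀ hσ.1
  -- the sums of the tables, as antidiagonal sums of the mode-table functions
  have hrepr : ∀ L : List ℕ, L.length + 1 = k →
      (dot L L.reverse : ℝ) / (D : ℝ) ^ 2 = ∑ p ∈ antidiagonal k, (lget L p.1 : ℝ) / D * ((lget L p.2 : ℝ) / D) := by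
    intro L hL
    have hL2 : L.length + 2 = k + 1 := by omega
    have hL1 : ∀ a, L.length + 1 - a = k - a := fun a => by omega
    rw [dot_reverse_eq_sum, hL2,
      Finset.Nat.sum_antidiagonal_eq_sum_range_succ (fun i j => (lget L i : ℝ) / D * ((lget L j : ℝ) / D)) k]
    simp only [hL1]
    push_cast
    rw [Finset.sum_div]
    refine sum_congr rfl fun i _ => ?_
    field_simp
  constructor
  · rw [hrepr mF hlen]
    refine antidiagonal_conv_mono k (m := fun i => (lget mF i : ℝ) / D) (f := fun i => e i σ)
      (by simp [lget_zero]) (he.zero σ) (fun i _ => by positivity) fun i hi1 hik => (htab i hi1 hik σ hσ).1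
  · rw [hrepr MF hLen]
    refine antidiagonal_conv_mono k (m := fun i => e i σ) (f := fun i => (lget MF i : ℝ) / D)
      (he.zero σ) (by simp [lget_zero]) (fun i _ => nonneg he hc i σ hσ0) fun i hi1 hik => (htab i hi1 hik σ hσ).2

/-- **SOUNDNESS OF ONE CELL.** If `mF`/`MF` (with reverses `mR`/`MR`) bound the modes `< k` on the cell, `lo`/`up` bound the modes
`k, k+1, …` at `t₀`, and `rho` brackets their decay factors, then `cellLoop` returns bounds at `t₁` (`newlo`, `newup`) and on the
cell (`mins`, `maxs`) for the modes `k, k+1, …`. [new here — MODEL] -/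
theorem cellLoop_sound (he : IsSineCascade 1 c e) (hc : 0 ≤ c) {D : ℕ} (hD : 0 < D) {t₀ t₁ : ℝ} (ht₀ : 0 ≤ t₀)
    (ht₁ : t₀ ≤ t₁) :
    ∀ (los ups rhs : List ℕ) (k : ℕ) (mF mR MF MR : List ℕ), 1 ≤ k → mR = mF.reverse → MR = MF.reverse →
      InTab e D t₀ t₁ k mF MF → Heads e D t₀ k los ups → RhoOK D t₀ t₁ k rhs → los.length = rhs.length →
      (Heads e D t₁ k (cellLoop D los ups rhs k mF mR MF MR).1 (cellLoop D los ups rhs k mF mR MF MR).2.1 ∧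
      CellB e D t₀ t₁ k (cellLoop D los ups rhs k mF mR MF MR).2.2.1 (cellLoop D los ups rhs k mF mR MF MR).2.2.2) ∧
      ((cellLoop D los ups rhs k mF mR MF MR).1.length = los.length ∧
       (cellLoop D los ups rhs k mF mR MF MR).2.1.length = los.length ∧
       (cellLoop D los ups rhs k mF mR MF MR).2.2.1.length = los.length ∧
       (cellLoop D los ups rhs k mF mR MF MR).2.2.2.length = los.length) := by
  intro los
  induction los with
  | nil =>
    intro ups rhs k mF mR MF MR hk hmR hMR htab hheads hrho hlen
    cases ups with
    | nil => cases rhs <;> exact ⟨⟨trivial, trivial⟩, by simp [cellLoop]⟩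
    | cons u ups => exact absurd hheads id
  | cons ℓ los ih =>
    intro ups rhs k mF mR MF MR hk hmR hMR htab hheads hrho hlen
    cases ups with
    | nil => exact absurd hheads id
    | cons u ups =>
      cases rhs with
      | nil => simp at hlen
      | cons ρ rhs =>
        obtain ⟨⟨hℓ, hu⟩, hheads'⟩ := hheads
        obtain ⟨⟨hρlo, hρhi, hρD⟩, hrho'⟩ := hrho
        -- the two new values of mode k
        have hconv := fun σ (hσ : σ ∈ Icc t₀ t₁) => conv_bounds he hc hD ht₀ htab hσ
        have hLo := stepLo_sound he hk hD ht₀ ht₁ (s := dot mF mR) (ℓ := ℓ) (ρ := ρ) hℓ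
          (fun σ hσ => by rw [hmR]; exact (hconv σ hσ).1) hρlo hρhi hρD
        have hUp := stepUp_sound he hk hD ht₀ ht₁ (S := dot MF MR) (u := u) (ρ := ρ) hu
          (fun σ hσ => by rw [hMR]; exact (hconv σ hσ).2) hρlo hρhi (by omega)
        -- the extended tables
        obtain ⟨hlenF, hlenM, htab'⟩ := htab
        set m : ℕ := min ℓ (stepLo D k (dot mF mR) ℓ ρ) with hm
        set M : ℕ := max u (stepUp D k (dot MF MR) u ρ) with hM
        have htab2 : InTab e D t₀ t₁ (k + 1) (mF ++ [m]) (MF ++ [M]) := by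
          refine ⟨by simp [hlenF], by simp [hlenM], fun a ha1 hak σ hσ => ?_⟩
          rcases Nat.lt_or_ge a k with hak' | hak'
          · rw [lget_append_left _ _ (by omega), lget_append_left _ _ (by omega)]
            exact htab' a ha1 hak' σ hσ
          · have hak : a = k := by omega
            subst hak
            rw [show a = mF.length + 1 by omega, lget_append_length_succ,
              show mF.length + 1 = MF.length + 1 by omega, lget_append_length_succ,
              show MF.length + 1 = a by omega]
            exact ⟨hLo.2 σ hσ, hUp.2 σ hσ⟩
        have ih' := ih ups rhs (k + 1) (mF ++ [m]) (m :: mR) (MF ++ [M]) (M :: MR) (by omega) (by simp [hmR])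
          (by simp [hMR]) htab2 hheads' hrho' (by simpa using hlen)
        obtain ⟨h1, h2, h3, h4⟩ := ih'.2
        simp only [cellLoop, List.length_cons]
        exact ⟨⟨⟨⟨hLo.1, hUp.1⟩, ih'.1.1⟩, ⟨fun σ hσ => ⟨hLo.2 σ hσ, hUp.2 σ hσ⟩, ih'.1.2⟩⟩,
          ⟨congrArg (· + 1) h1, congrArg (· + 1) h2, congrArg (· + 1) h3, congrArg (· + 1) h4⟩⟩

end Sound

end CellChain
end SheetNSLineTorusCascade
end Summit.NavierStokesRegularity.OSWSelfSimilar
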